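import Summits.Ventures.PercRepro0.Coupling
import Summits.Ventures.PercRepro0.ZeroOneKolmogorov
import Summits.Ventures.PercRepro0.ContinuityCoupling
import Summits.Ventures.PercRepro0.LowerBound

/-!
# PM-A · CONTINUITY-ABOVE on the cell's definitions (seat p3)

Kernel-checked twin of route/TMID-PLAN-plan-2-v1.md §3.1 (block M; a REDUCTION / equivalent form of
the residual, not progress on its truth): for `d ≥ 1` and P3 · UNIQUE in dimension `d`,

* `continuousWithinAt_theta_Iio` — `θ_d` is left-continuous at every `p ∈ (p_c(d), 1]`;
* `T_iff_continuousOn_theta` — consequently `T d ⟺ θ_d` is continuous on `[0,1]`.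

Proof (the plan's sketch, line by line). On the threshold coupling of `Coupling.lean` — i.i.d. uniform
labels `U_e`, `ω_p(U) = {e ∈ 𝔼^d : U_e ≤ p}`, law `P_p` (`Q_preimage`) — fix `p_c < p' < p`. `Q`-a.s.:
(1) some infinite cluster exists at level `p'` (L5 at `p'`, `θ_d(p') > 0`); (2) at most one infinite
cluster at level `p` (P3 at `p`); (3) no label equals `p` (`Q_ties`: countably many Lebesgue-null events).
On `{0 ↔_p ∞}`: the infinite `p'`-cluster is `p`-open, so by (2) it is joined to `0` by a `p`-open path;
its labels are `< p` by (3), so with `q := max(p', labels)` the path and the cluster are `q`-open and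
`0 ↔_q ∞` (`exists_lt_of_connInf`). Hence `{0 ↔_p ∞} ⊆ N ∪ ⋃ₙ {0 ↔_{q_n} ∞}` for the levels
`q_n = max(p', p − 1/(n+1)) ↑ p`, and continuity of `Q` from below gives `θ_d(p) ≤ sup_n θ_d(q_n)`
(`P_percolates_le_iSup`); the reverse is L1. So `θ_d(q_n) → θ_d(p)` (`tendsto_thetaI_seq`) and, by
monotonicity, `θ_d` is left-continuous at `p`. Right-continuity everywhere is L2 (p5's
`continuousWithinAt_theta_Ioi`), `θ_d = 0` below `p_c` (L0) and `p_c(d) > 0` (p2's L4 bound), so the only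
possible discontinuity is at `p_c(d)`, and continuity there is exactly `T d`.

Inputs: Coupling (L1, the coupling), ZeroOneKolmogorov (L5), ContinuityCoupling (L2), LowerBound (L4(i)),
Events (F1); the hypothesis `P3_Unique d` is Burton–Keane (UNIQUENESS-p6-v1). Only the direction
«left-continuity above `p_c`» uses P3. Nothing here decides `T d` for any `3 ≤ d ≤ 10`.
-/

namespace Summit.Ventures.PercRepro0.ContAbove

open MeasureTheory ProbabilityTheory unitInterval Set Filter Topology Defs
open scoped ENNReal

variable {d : ℕ}

/-- The coupling measure `Q`: i.i.d. uniform labels `U_e ∈ [0,1]` on the unordered pairs of vertices. -/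
noncomputable def Q (d : ℕ) : Measure (Sym2 (Vertex d) → ℝ) :=
  Measure.infinitePi fun _ : Sym2 (Vertex d) => unif

/-- `Q` is a probability measure. -/
theorem isProbabilityMeasure_Q : IsProbabilityMeasure (Q d) := by
  unfold Q
  infer_instance

/-- The configuration at level `p`: `ω_p(U) = { e ∈ 𝔼^d : U_e ≤ p }`. -/
def cfg (d : ℕ) (p : I) (U : Sym2 (Vertex d) → ℝ) : Config d := threshold (bonds d) p U

/-- `U ↦ ω_p(U)` is measurable. -/
theorem measurable_cfg (p : I) : Measurable (cfg d p) := measurable_threshold _ _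

/-- `ω_p(U) ⊆ ω_q(U)` for `p ≤ q`. -/
theorem cfg_mono {p q : I} (hpq : p ≤ q) (U : Sym2 (Vertex d) → ℝ) : cfg d p U ⊆ cfg d q U :=
  threshold_mono _ hpq U

/-- `e ∈ ω_p(U)` iff `e` is a bond with `U_e ≤ p`. -/
theorem mem_cfg {p : I} {U : Sym2 (Vertex d) → ℝ} {e : Sym2 (Vertex d)} :
    e ∈ cfg d p U ↔ e ∈ bonds d ∧ U e ≤ (p : ℝ) := Iff.rfl

/-- The law of `ω_p` under `Q` is `P_p` (the threshold coupling of `Coupling.lean`). -/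
theorem Q_preimage (p : I) {A : Set (Config d)} (hA : MeasurableSet A) :
    Q d (cfg d p ⁻¹' A) = P d p A := by
  rw [← Measure.map_apply (measurable_cfg p) hA]
  unfold Q cfg P
  rw [map_threshold_eq_setBernoulli]

/-- The labels with some pair exactly at level `p` (a `Q`-null set). -/
def ties (d : ℕ) (p : I) : Set (Sym2 (Vertex d) → ℝ) := {U | ∃ e, U e = (p : ℝ)}

/-- One label equals `p` with `Q`-probability `0` (Lebesgue null). -/
theorem Q_eval_eq_zero (e : Sym2 (Vertex d)) (p : I) : Q d {U | U e = (p : ℝ)} = 0 := by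
  have h : {U : Sym2 (Vertex d) → ℝ | U e = (p : ℝ)} = (fun U => U e) ⁻¹' {(p : ℝ)} := rfl
  rw [h, ← Measure.map_apply (measurable_pi_apply e) (measurableSet_singleton _)]
  unfold Q
  rw [Measure.infinitePi_map_eval]
  unfold unif
  rw [Measure.restrict_apply (measurableSet_singleton _)]
  exact measure_mono_null inter_subset_left Real.volume_singleton

/-- The unordered pairs of lattice points form a countable type. -/
theorem countable_sym2Vertex : Countable (Sym2 (Vertex d)) :=
  Quot.mk_surjective.countable

/-- `Q`-a.s. no label equals `p` (countably many null events). -/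
theorem Q_ties (p : I) : Q d (ties d p) = 0 := by
  haveI := countable_sym2Vertex (d := d)
  have h : ties d p = ⋃ e : Sym2 (Vertex d), {U | U e = (p : ℝ)} := by
    ext U
    simp [ties]
  rw [h]
  exact measure_iUnion_null fun e => Q_eval_eq_zero e p


/-! ### The combinatorial core -/

/-- `0 ↔ x` and `x ↔ ∞` give `0 ↔ ∞` (the cluster of `0` contains the cluster of `x`). -/
theorem connInf_of_conn {ω : Config d} {x : Vertex d} (h0x : Conn d ω 0 x) (hx : ConnInf d ω x) :
    ConnInf d ω 0 :=
  hx.mono fun _ hy => h0x.trans hy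

/-- Core of PM-A (deterministic, on the good labels): if at level `p` the origin percolates, some
infinite cluster exists at level `p' < p`, there is at most one infinite cluster at level `p`, and no
label equals `p`, then the origin already percolates at some level `q ∈ [p', p)`. -/
theorem exists_lt_of_connInf {p' p : I} (hp'p : (p' : ℝ) < p) (U : Sym2 (Vertex d) → ℝ)
    (hE : ∃ x, ConnInf d (cfg d p' U) x) (hUniq : cfg d p U ∈ atMostOneInfCluster d)
    (hties : U ∉ ties d p) (h0 : ConnInf d (cfg d p U) 0) :
    ∃ q : I, p' ≤ q ∧ (q : ℝ) < p ∧ ConnInf d (cfg d q U) 0 := by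
  classical
  obtain ⟨x, hx⟩ := hE
  have hxp : ConnInf d (cfg d p U) x := connInf_mono (cfg_mono hp'p.le U) hx
  have hconn : Conn d (cfg d p U) 0 x := hUniq 0 x h0 hxp
  obtain ⟨w, hw⟩ := (conn_iff_exists_walk _ 0 x).1 hconn
  set T : Finset ℝ := insert (p' : ℝ) (w.edges.toFinset.image U) with hT
  have hTne : T.Nonempty := Finset.insert_nonempty _ _
  set m : ℝ := T.max' hTne with hm
  have hp'm : (p' : ℝ) ≤ m := Finset.le_max' T _ (Finset.mem_insert_self _ _)
  have hem : ∀ e ∈ w.edges, U e ≤ m := fun e he =>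
    Finset.le_max' T _ (Finset.mem_insert_of_mem (Finset.mem_image_of_mem U (List.mem_toFinset.2 he)))
  have hmp : m < p := by
    rw [hm, Finset.max'_lt_iff]
    intro b hb
    rw [hT, Finset.mem_insert, Finset.mem_image] at hb
    rcases hb with rfl | ⟨e, he, rfl⟩
    · exact hp'p
    · have he' : e ∈ cfg d p U := hw e (List.mem_toFinset.1 he)
      have hle : U e ≤ p := (mem_cfg.1 he').2
      have hne : U e ≠ p := fun h => hties ⟨e, h⟩
      exact lt_of_le_of_ne hle hne
  have hm0 : 0 ≤ m := p'.2.1.trans hp'm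
  have hm1 : m ≤ 1 := hmp.le.trans p.2.2
  refine ⟨⟨m, hm0, hm1⟩, hp'm, hmp, ?_⟩
  have hconn_m : Conn d (cfg d ⟨m, hm0, hm1⟩ U) 0 x := by
    rw [conn_iff_exists_walk]
    exact ⟨w, fun e he => mem_cfg.2 ⟨(mem_cfg.1 (hw e he)).1, hem e he⟩⟩
  have hx_m : ConnInf d (cfg d ⟨m, hm0, hm1⟩ U) x :=
    connInf_mono (cfg_mono (show p' ≤ ⟨m, hm0, hm1⟩ from hp'm) U) hx
  exact connInf_of_conn hconn_m hx_m

/-! ### An increasing sequence of levels `q_n ↑ p` starting at `p'` -/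

/-- `q_n = max (p', p − 1/(n+1))`, an element of the unit interval for `p' ≤ p`. -/
noncomputable def seq (p' p : I) (h : p' ≤ p) (n : ℕ) : I :=
  ⟨max (p' : ℝ) ((p : ℝ) - 1 / ((n : ℝ) + 1)),
    p'.2.1.trans (le_max_left _ _),
    (max_le (Subtype.coe_le_coe.2 h)
      (by linarith [show (0 : ℝ) ≤ 1 / ((n : ℝ) + 1) by positivity])).trans p.2.2⟩

/-- `p' ≤ q_n`. -/
theorem le_seq (p' p : I) (h : p' ≤ p) (n : ℕ) : p' ≤ seq p' p h n :=
  Subtype.coe_le_coe.1 (le_max_left _ _)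

/-- `q_n ≤ p`. -/
theorem seq_le (p' p : I) (h : p' ≤ p) (n : ℕ) : seq p' p h n ≤ p :=
  Subtype.coe_le_coe.1 (max_le (Subtype.coe_le_coe.2 h)
    (by linarith [show (0 : ℝ) ≤ 1 / ((n : ℝ) + 1) by positivity]))

/-- `n ↦ q_n` is non-decreasing. -/
theorem seq_mono (p' p : I) (h : p' ≤ p) : Monotone (seq p' p h) := by
  intro m n hmn
  apply Subtype.coe_le_coe.1
  apply max_le_max le_rfl
  have h1 : (1 : ℝ) / ((n : ℝ) + 1) ≤ 1 / ((m : ℝ) + 1) :=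
    one_div_le_one_div_of_le (by positivity) (by exact_mod_cast Nat.succ_le_succ hmn)
  linarith

/-- Every level `q < p` is eventually below `q_n`. -/
theorem exists_le_seq (p' p : I) (h : p' ≤ p) {q : I} (hq : (q : ℝ) < p) :
    ∃ n, q ≤ seq p' p h n := by
  obtain ⟨n, hn⟩ := exists_nat_one_div_lt (sub_pos.2 hq)
  refine ⟨n, Subtype.coe_le_coe.1 ?_⟩
  show (q : ℝ) ≤ max (p' : ℝ) ((p : ℝ) - 1 / ((n : ℝ) + 1))
  exact le_max_of_le_right (by linarith)

/-! ### Continuity from below at every `p` above `p_c` -/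

/-- The `Q`-null «bad» set at level `p` (given `θ_d(p') > 0` and P3 at `p`): a tie at `p`, no
infinite cluster at `p'`, or two infinite clusters at `p`. -/
def bad (d : ℕ) (p' p : I) : Set (Sym2 (Vertex d) → ℝ) :=
  ties d p ∪ (cfg d p' ⁻¹' existsInfCluster d)ᶜ ∪ (cfg d p ⁻¹' atMostOneInfCluster d)ᶜ

/-- The bad set is `Q`-null when `θ_d(p') > 0` and P3 holds at `p`. -/
theorem Q_bad (p' p : I) (hθ' : 0 < thetaI d p') (hP3 : P3_Unique d) : Q d (bad d p' p) = 0 := by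
  haveI := isProbabilityMeasure_Q (d := d)
  have h1 : Q d (cfg d p' ⁻¹' existsInfCluster d)ᶜ = 0 := by
    rw [prob_compl_eq_zero_iff ((measurable_cfg p') measurableSet_existsInfCluster),
      Q_preimage p' measurableSet_existsInfCluster]
    exact (L5_ZeroOne_holds d p').2.2 hθ'
  have h2 : Q d (cfg d p ⁻¹' atMostOneInfCluster d)ᶜ = 0 := by
    rw [prob_compl_eq_zero_iff ((measurable_cfg p) measurableSet_atMostOneInfCluster),
      Q_preimage p measurableSet_atMostOneInfCluster]
    exact hP3 p
  exact measure_union_null (measure_union_null (Q_ties p) h1) h2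

/-- Off the bad set, `{0 ↔_p ∞} ⊆ ⋃ₙ {0 ↔_{q_n} ∞}`. -/
theorem preimage_percolates_subset {p' p : I} (hp'p : (p' : ℝ) < p) :
    cfg d p ⁻¹' percolates d ⊆
      bad d p' p ∪ ⋃ n, cfg d (seq p' p hp'p.le n) ⁻¹' percolates d := by
  intro U hU
  by_cases hb : U ∈ bad d p' p
  · exact Or.inl hb
  · right
    simp only [bad, mem_union, mem_compl_iff, not_or, not_not] at hb
    obtain ⟨⟨hties, hE⟩, hUniq⟩ := hb
    obtain ⟨q, hp'q, hqp, hq⟩ := exists_lt_of_connInf hp'p U hE hUniq hties hU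
    obtain ⟨n, hn⟩ := exists_le_seq p' p hp'p.le hqp
    exact mem_iUnion.2 ⟨n, connInf_mono (cfg_mono hn U) hq⟩

/-- `θ_d(p) ≤ sup_n θ_d(q_n)` (as measures), for `p_c < p' < p` and P3 at `p`. -/
theorem P_percolates_le_iSup {p' p : I} (hp'p : (p' : ℝ) < p) (hθ' : 0 < thetaI d p')
    (hP3 : P3_Unique d) :
    P d p (percolates d) ≤ ⨆ n, P d (seq p' p hp'p.le n) (percolates d) := by
  have hmono : Monotone fun n => cfg d (seq p' p hp'p.le n) ⁻¹' percolates d := by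
    intro m n hmn U hU
    exact connInf_mono (cfg_mono (seq_mono p' p hp'p.le hmn) U) hU
  calc P d p (percolates d) = Q d (cfg d p ⁻¹' percolates d) :=
        (Q_preimage p measurableSet_percolates).symm
    _ ≤ Q d (bad d p' p ∪ ⋃ n, cfg d (seq p' p hp'p.le n) ⁻¹' percolates d) :=
        measure_mono (preimage_percolates_subset hp'p)
    _ ≤ Q d (bad d p' p) + Q d (⋃ n, cfg d (seq p' p hp'p.le n) ⁻¹' percolates d) :=
        measure_union_le _ _
    _ = Q d (⋃ n, cfg d (seq p' p hp'p.le n) ⁻¹' percolates d) := by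
        rw [Q_bad p' p hθ' hP3, zero_add]
    _ = ⨆ n, Q d (cfg d (seq p' p hp'p.le n) ⁻¹' percolates d) :=
        hmono.measure_iUnion
    _ = ⨆ n, P d (seq p' p hp'p.le n) (percolates d) := by
        simp_rw [Q_preimage _ measurableSet_percolates]

/-- PM-A, sequence form: `θ_d(q_n) → θ_d(p)` as `n → ∞` for `p_c < p' < p` and P3 at `p`. -/
theorem tendsto_thetaI_seq {p' p : I} (hp'p : (p' : ℝ) < p) (hθ' : 0 < thetaI d p')
    (hP3 : P3_Unique d) :
    Tendsto (fun n => thetaI d (seq p' p hp'p.le n)) atTop (𝓝 (thetaI d p)) := by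
  have hmono : Monotone fun n => P d (seq p' p hp'p.le n) (percolates d) := fun m n hmn =>
    L1_Monotone_holds d _ _ (seq_mono p' p hp'p.le hmn) _ isUpperSet_percolates
      measurableSet_percolates
  have hsup : (⨆ n, P d (seq p' p hp'p.le n) (percolates d)) = P d p (percolates d) := by
    refine le_antisymm (iSup_le fun n => ?_) (P_percolates_le_iSup hp'p hθ' hP3)
    exact L1_Monotone_holds d _ _ (seq_le p' p hp'p.le n) _ isUpperSet_percolates
      measurableSet_percolates
  have h : Tendsto (fun n => P d (seq p' p hp'p.le n) (percolates d)) atTop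
      (𝓝 (P d p (percolates d))) := by
    rw [← hsup]
    exact tendsto_atTop_iSup hmono
  exact (ENNReal.tendsto_toReal (measure_ne_top _ _)).comp h

/-- `clamp` is the identity on the unit interval. -/
theorem clamp_coe (q : I) : clamp (q : ℝ) = q := by
  unfold clamp
  exact Set.projIcc_val zero_le_one q

/-- **PM-A · CONTINUITY-ABOVE** (TMID-PLAN-plan-2-v1 §3.1): for `d ≥ 1` and P3 in dimension `d`,
`θ_d` is left-continuous at every `p ∈ (p_c(d), 1]`. -/
theorem continuousWithinAt_theta_Iio (hd : 1 ≤ d) (hP3 : P3_Unique d) {p : ℝ} (hp : pc d < p)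
    (hp1 : p ≤ 1) : ContinuousWithinAt (theta d) (Iio p) p := by
  -- the auxiliary level `p' = (p_c + p)/2 ∈ (p_c, p)`
  set p'r : ℝ := (pc d + p) / 2 with hp'r
  have hp'lt : pc d < p'r := by rw [hp'r]; linarith
  have hp'p : p'r < p := by rw [hp'r]; linarith
  have hp'0 : 0 ≤ p'r := (pc_nonneg (d := d)).trans hp'lt.le
  have hp'1 : p'r ≤ 1 := hp'p.le.trans hp1
  have hp0 : 0 ≤ p := hp'0.trans hp'p.le
  set p' : I := ⟨p'r, hp'0, hp'1⟩ with hp'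
  set pI : I := ⟨p, hp0, hp1⟩ with hpI
  have hθ' : 0 < thetaI d p' := by
    have := theta_pos_of_pc_lt' hd hp'lt hp'1
    unfold theta at this
    rwa [show clamp p'r = p' from clamp_coe p'] at this
  have hlt : (p' : ℝ) < pI := hp'p
  have hlim := tendsto_thetaI_seq hlt hθ' hP3
  rw [Metric.continuousWithinAt_iff]
  intro ε hε
  obtain ⟨N, hN⟩ := (Metric.tendsto_atTop.1 hlim) ε hε
  have hqN : (seq p' pI hlt.le N : ℝ) < p := by
    show (seq p' pI hlt.le N : ℝ) < (pI : ℝ)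
    -- `q_N = max (p', p − 1/(N+1)) < p`
    apply max_lt hp'p
    have : (0 : ℝ) < 1 / ((N : ℝ) + 1) := by positivity
    linarith
  refine ⟨p - seq p' pI hlt.le N, sub_pos.2 hqN, fun q hq hdist => ?_⟩
  have hqlt : q < p := hq
  have hqN' : (seq p' pI hlt.le N : ℝ) < q := by
    rw [Real.dist_eq, abs_lt] at hdist
    linarith [hdist.1]
  have h1 : theta d (seq p' pI hlt.le N : ℝ) ≤ theta d q := theta_mono hqN'.le
  have h2 : theta d q ≤ theta d p := theta_mono hqlt.le
  have hN' := hN N le_rfl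
  rw [Real.dist_eq, abs_lt] at hN'
  have hθN : theta d (seq p' pI hlt.le N : ℝ) = thetaI d (seq p' pI hlt.le N) := by
    unfold theta
    rw [clamp_coe]
  have hθp : theta d p = thetaI d pI := by
    unfold theta
    rw [show clamp p = pI from clamp_coe pI]
  rw [Real.dist_eq, abs_lt]
  constructor <;> linarith

/-! ### Consequence: `T d ⟺ θ_d ∈ C([0,1])` -/

/-- `θ_d = 0` on `(−∞, p_c(d))` (L0 plus the clamp). -/
theorem theta_eq_zero_of_lt_pc' (hd : 1 ≤ d) {p : ℝ} (hp : p < pc d) : theta d p = 0 := by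
  by_cases h0 : 0 ≤ p
  · exact theta_eq_zero_of_lt_pc hd h0 hp
  · have h0' : p < 0 := not_le.1 h0
    refine le_antisymm ?_ (theta_nonneg d p)
    calc theta d p ≤ theta d 0 := theta_mono h0'.le
      _ = 0 := theta_zero

/-- `0 < p_c(d)` for `d ≥ 1` (from p2's L4 bound `1/(2d) ≤ p_c(d)`, LowerBound.lean). -/
theorem pc_pos (hd : 1 ≤ d) : 0 < pc d := by
  refine lt_of_lt_of_le ?_ (L2.inv_two_d_le_pc hd ⟨1, one_mem_pcSet hd⟩)
  have : (1 : ℝ) ≤ d := by exact_mod_cast hd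
  positivity

/-- Two-sided continuity at `p > p_c(d)`: PM-A (left) and L2 (right). -/
theorem continuousAt_theta_of_pc_lt (hd : 1 ≤ d) (hP3 : P3_Unique d) {p : ℝ} (hp : pc d < p)
    (hp1 : p ≤ 1) : ContinuousAt (theta d) p := by
  rw [← continuousWithinAt_compl_self, ← Iio_union_Ioi]
  exact (continuousWithinAt_theta_Iio hd hP3 hp hp1).union (continuousWithinAt_theta_Ioi p)

/-- Continuity at `p < p_c(d)`: `θ_d` vanishes on the open set `(−∞, p_c(d))`. -/
theorem continuousAt_theta_of_lt_pc (hd : 1 ≤ d) {p : ℝ} (hp : p < pc d) :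
    ContinuousAt (theta d) p := by
  refine (continuousAt_const : ContinuousAt (fun _ : ℝ => (0 : ℝ)) p).congr ?_
  filter_upwards [Iio_mem_nhds hp] with q hq
  exact (theta_eq_zero_of_lt_pc' hd hq).symm

/-- At `p_c(d)` itself, `T d` gives continuity (left: `θ_d = 0` below `p_c`; right: L2). -/
theorem continuousAt_theta_pc_of_T (hd : 1 ≤ d) (hT : T d) : ContinuousAt (theta d) (pc d) := by
  rw [← continuousWithinAt_compl_self, ← Iio_union_Ioi]
  refine ContinuousWithinAt.union ?_ (continuousWithinAt_theta_Ioi (pc d))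
  have hT' : theta d (pc d) = 0 := hT
  rw [ContinuousWithinAt, hT']
  refine tendsto_const_nhds.congr' ?_
  filter_upwards [self_mem_nhdsWithin] with q hq
  exact (theta_eq_zero_of_lt_pc' hd hq).symm

/-- PM-A consequence (⇒): under P3, `T d` makes `θ_d` continuous on `[0,1]` (indeed on all of `ℝ`
restricted to the clamp's range; we state it on `[0,1]`). -/
theorem continuousOn_theta_of_T (hd : 1 ≤ d) (hP3 : P3_Unique d) (hT : T d) :
    ContinuousOn (theta d) (Icc 0 1) := by
  intro p hp
  refine ContinuousAt.continuousWithinAt ?_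
  rcases lt_trichotomy p (pc d) with hlt | heq | hgt
  · exact continuousAt_theta_of_lt_pc hd hlt
  · rw [heq]
    exact continuousAt_theta_pc_of_T hd hT
  · exact continuousAt_theta_of_pc_lt hd hP3 hgt hp.2

/-- PM-A consequence (⇐): if `θ_d` is continuous on `[0,1]` at `p_c(d)` then `T d` (`θ_d = 0` on
`[0, p_c)`, which accumulates at `p_c(d) > 0`). -/
theorem T_of_continuousWithinAt (hd : 1 ≤ d)
    (hc : ContinuousWithinAt (theta d) (Icc 0 1) (pc d)) : T d := by
  have hpos := pc_pos hd
  have hpc1 := pc_le_one hd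
  -- the filter `𝓝[Ici 0 ∩ Iio p_c] p_c` is non-trivial and lies in `𝓝[Icc 0 1] p_c`
  have hsub : Ici 0 ∩ Iio (pc d) ⊆ Icc 0 1 := fun q hq => ⟨hq.1, hq.2.le.trans hpc1⟩
  have hfilt : 𝓝[Ici 0 ∩ Iio (pc d)] (pc d) = 𝓝[Iio (pc d)] (pc d) :=
    nhdsWithin_inter_of_mem (mem_nhdsWithin_of_mem_nhds (Ici_mem_nhds hpos))
  have hne : (𝓝[Ici 0 ∩ Iio (pc d)] (pc d)).NeBot := by
    rw [hfilt]
    infer_instance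
  have h1 : Tendsto (theta d) (𝓝[Ici 0 ∩ Iio (pc d)] (pc d)) (𝓝 (theta d (pc d))) :=
    tendsto_nhdsWithin_mono_left hsub hc
  have h2 : Tendsto (theta d) (𝓝[Ici 0 ∩ Iio (pc d)] (pc d)) (𝓝 0) := by
    refine tendsto_const_nhds.congr' ?_
    filter_upwards [self_mem_nhdsWithin] with q hq
    exact (theta_eq_zero_of_lt_pc' hd hq.2).symm
  exact tendsto_nhds_unique h1 h2

/-- **PM-A, the equivalence** (TMID-PLAN-plan-2-v1 §3.1, second sentence): for `d ≥ 1` and P3 in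
dimension `d`, `T d ⟺ θ_d` is continuous on `[0,1]`. -/
theorem T_iff_continuousOn_theta (hd : 1 ≤ d) (hP3 : P3_Unique d) :
    T d ↔ ContinuousOn (theta d) (Icc 0 1) :=
  ⟨continuousOn_theta_of_T hd hP3, fun hc => T_of_continuousWithinAt hd (hc _ (pc_mem_Icc hd))⟩

end Summit.Ventures.PercRepro0.ContAbove
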